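import Summits.ResolutionOfSingularities.ResolutionOfSingularities.Theorems.PurelyInseparableDim4SpivakovskyDeltaRules
import HarnessLib

/-!
# [OURS · res-dim4-pi I-8-1 T3] The rule R_W («δ-steepest descent») of CARD I-8-1 is a tree object, and it WINS

Cell `res-dim4-pi` (D-0157 DOOR 2), seat `res-dim4-p-11`; brick T3 of CARD I-8-1 (idea-8, `cards/idea-8.md` 1de998a813b1282c,
memo `LEMMA-WT.md` §4; crit-1 V-A-18 «ALIVE … THEOREM-CANDIDATE», grade NEW-COMBINATION; crit-2 V-B-24).  [OURS — the rule is
the cell's; its termination rests on Spivakovsky's `δ` [cite: Spivakovsky1983, §I (δ(Δ)), §III Proposition] through T1/T2.]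

THE RULE (idea-8, EVAL `I-8-1.py` 6bb8364efa333621, tie-break of the 18:09:44Z bus line): at a position `A` (support of the
cleaned `F`, threshold `q`) score every permissible coordinate centre `Γ` by `sc(Γ)` = the list of the `δ`'s of its NOT-YET-WON
children `pureMove q Γ j A` (`j ∈ Γ`), sorted DESCENDING in the (prefix-)lex order; `R_W(A)` = the permissible `Γ` with the
lex-LEAST score, ties broken by `(|Γ|, Γ lex)`.

* §1 `childDeltas`, `scoreW` (descending insertion sort), `ruleW q : SpineStrategy` (first minimiser of `scoreW` along
  `candidatesLex univ` = least score, then least cardinality, then lex — `List.argmin` keeps the first of ties);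
* §2 `spinePermissible_ruleW`; the domination step `scoreW_ruleW_le` (`sc(R_W(A)) ≤ sc(Γ)` for every permissible `Γ`, in
  particular for R_S's `spineRuleLex q A`) and `le_head_scoreW` (every non-won child's `δ` is `≤` the head of the sorted score);
* §3 **`isDeltaDescending_ruleW`** (via `isDeltaDescending_of_dominated`: the largest child `δ` of R_W is `≤` the largest child `δ`
  of R_S, which is `< δ(A)` by T1) and **`isPurePositionalWin_ruleW : 0 < q → IsPurePositionalWin q (ruleW q)`** (by T2) — CARD
  I-8-1's (L1)+(L2) as a kernel theorem: R_W wins Hironaka's polyhedra game (four variables, strict threshold) from every position;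
  `isSpinePositionalWin_ruleW` (with deletions).

HONEST SCOPE: a statement about the SPINE (chart origins) of OUR frame; (W-iv) «efficiency» is a census matter, not claimed;
nothing here bears on F4-C / TIER 2 or proves resolution of singularities in dimension ≥ 4 / characteristic `p`.
[OURS · counted 0 · AI work weaker than expert review] bears_on: LADDER-RESOLUTION:D157-DOOR2 (res-dim4-pi · I-8-1 T3).
Supports stmt-ResolutionOfSingularities-16155 (helper).
-/

set_option linter.dupNamespace false -- mandated namespace of this single-conjunct summit

open Finset
open scoped BigOperators

namespace Summit.ResolutionOfSingularities.ResolutionOfSingularities.Theorems.PIDim4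

namespace Spivakovsky

open Literature.AlgebraicGeometry.Resolution
open Literature.AlgebraicGeometry.Resolution.CentreBlowup

/-! ## §1 The score and the rule -/

/-- The `δ`'s of the not-yet-won children of the centre `Γ` at `A` (charts `j ∈ Γ` in increasing order).
[folklore] -/
noncomputable def childDeltas (q : ℕ) (A : SpinePos) (Γ : Finset (Fin 4)) : List (List (WithTop ℚ)) := by
  classical
  exact ((sortedList Γ).filter (fun j => ¬ SpineWon q (pureMove q Γ j A))).map
    (fun j => deltaSpine q (pureMove q Γ j A))

/-- **The score `sc(Γ)`**: the children's `δ`'s sorted DESCENDING (largest first) in the lex order of lists.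
[folklore] -/
noncomputable def scoreW (q : ℕ) (A : SpinePos) (Γ : Finset (Fin 4)) : List (List (WithTop ℚ)) :=
  (childDeltas q A Γ).insertionSort (fun s t => t ≤ s)

/-- The permissible candidate centres at `A`, as increasing index lists in the order (cardinality, lex). [folklore] -/
noncomputable def candidatesW (q : ℕ) (A : SpinePos) : List (List (Fin 4)) := by
  classical
  exact (candidatesLex (Finset.univ : Finset (Fin 4))).filter (fun c => SpinePermissible q c.toFinset A)

/-- **R_W, the δ-steepest-descent rule of CARD I-8-1**: the permissible centre with the lex-least score; among ties the
first in the order (cardinality, lex) (`List.argmin` keeps the first minimiser); the point `univ` if nothing is permissible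
(only at won positions). [folklore] -/
noncomputable def ruleW (q : ℕ) : SpineStrategy := fun A =>
  (((candidatesW q A).argmin (fun c => scoreW q A c.toFinset)).map List.toFinset).getD Finset.univ

/-! ## §2 Permissibility and domination -/

section RuleW

variable {q : ℕ}

/-- Membership in the candidate list. [folklore] -/
theorem mem_candidatesW_iff {A : SpinePos} {c : List (Fin 4)} :
    c ∈ candidatesW q A ↔ c ∈ candidatesLex (Finset.univ : Finset (Fin 4)) ∧ SpinePermissible q c.toFinset A := by
  classical
  simp [candidatesW, List.mem_filter]

/-- Every permissible `Γ` is (the finset of) a candidate. [folklore] -/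
theorem exists_candidate_of_spinePermissible {A : SpinePos} {Γ : Finset (Fin 4)} (hΓ : SpinePermissible q Γ A) :
    ∃ c ∈ candidatesW q A, c.toFinset = Γ := by
  obtain ⟨c, hc, hcF⟩ := exists_mem_combosLex_of_subset (Finset.subset_univ Γ)
  refine ⟨c, mem_candidatesW_iff.mpr ⟨?_, by rw [hcF]; exact hΓ⟩, hcF⟩
  simp only [candidatesLex, List.mem_flatMap, List.mem_range]
  exact ⟨Γ.card, Nat.lt_succ_of_le (Finset.card_le_card (Finset.subset_univ Γ)), hc⟩

/-- While A has not won, `univ` is permissible, so candidates exist and `ruleW` is an `argmin`. [folklore] -/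
theorem exists_ruleW_eq {A : SpinePos} (hA : ¬ SpineWon q A) :
    ∃ c ∈ (candidatesW q A).argmin (fun c => scoreW q A c.toFinset), ruleW q A = c.toFinset := by
  have huniv : SpinePermissible q (Finset.univ : Finset (Fin 4)) A := by
    refine ⟨Finset.univ_nonempty, fun a ha => ?_⟩
    by_contra hlt
    push Not at hlt
    rw [degIn_univ] at hlt
    exact hA (Or.inr ⟨a, ha, hlt⟩)
  obtain ⟨c₀, hc₀, -⟩ := exists_candidate_of_spinePermissible huniv
  have hne : (candidatesW q A).argmin (fun c => scoreW q A c.toFinset) ≠ none := by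
    rw [Ne, List.argmin_eq_none]
    exact List.ne_nil_of_mem hc₀
  obtain ⟨c, hc⟩ := Option.ne_none_iff_exists'.mp hne
  exact ⟨c, hc, by simp [ruleW, hc]⟩

/-- **R_W is permissible** while A has not won. [folklore] -/
theorem spinePermissible_ruleW {A : SpinePos} (hA : ¬ SpineWon q A) : SpinePermissible q (ruleW q A) A := by
  obtain ⟨c, hc, hcW⟩ := exists_ruleW_eq hA
  rw [hcW]
  exact (mem_candidatesW_iff.mp (List.argmin_mem hc)).2

/-- **Domination**: the score of `R_W(A)` is `≤` the score of every permissible centre. [folklore] -/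
theorem scoreW_ruleW_le {A : SpinePos} (hA : ¬ SpineWon q A) {Γ : Finset (Fin 4)} (hΓ : SpinePermissible q Γ A) :
    scoreW q A (ruleW q A) ≤ scoreW q A Γ := by
  obtain ⟨c, hc, hcW⟩ := exists_ruleW_eq hA
  obtain ⟨c', hc', hc'F⟩ := exists_candidate_of_spinePermissible hΓ
  rw [hcW, ← hc'F]
  exact List.le_of_mem_argmin (f := fun c : List (Fin 4) => scoreW q A c.toFinset) hc' (by convert hc)

/-- The `δ` of a not-yet-won child is a member of the children's list. [folklore] -/
theorem mem_childDeltas {A : SpinePos} {Γ : Finset (Fin 4)} {j : Fin 4} (hj : j ∈ Γ)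
    (hnw : ¬ SpineWon q (pureMove q Γ j A)) : deltaSpine q (pureMove q Γ j A) ∈ childDeltas q A Γ := by
  classical
  unfold childDeltas
  simp only [List.mem_map, List.mem_filter, mem_sortedList_iff, decide_eq_true_eq]
  exact ⟨j, ⟨hj, hnw⟩, rfl⟩

/-- Members of the score are `δ`'s of not-yet-won children. [folklore] -/
theorem exists_of_mem_scoreW {A : SpinePos} {Γ : Finset (Fin 4)} {s : List (WithTop ℚ)} (hs : s ∈ scoreW q A Γ) :
    ∃ j ∈ Γ, ¬ SpineWon q (pureMove q Γ j A) ∧ deltaSpine q (pureMove q Γ j A) = s := by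
  classical
  unfold scoreW at hs
  rw [List.mem_insertionSort] at hs
  unfold childDeltas at hs
  simp only [List.mem_map, List.mem_filter, mem_sortedList_iff, decide_eq_true_eq] at hs
  obtain ⟨j, ⟨hj, hnw⟩, rfl⟩ := hs
  exact ⟨j, hj, hnw, rfl⟩

/-- The score is sorted descending: its head dominates all its members. [folklore] -/
theorem le_head_scoreW {A : SpinePos} {Γ : Finset (Fin 4)} {s t : List (WithTop ℚ)} {rest : List (List (WithTop ℚ))}
    (h : scoreW q A Γ = t :: rest) (hs : s ∈ scoreW q A Γ) : s ≤ t := by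
  haveI : Std.Total (fun s t : List (WithTop ℚ) => t ≤ s) := ⟨fun a b => le_total b a⟩
  haveI : IsTrans (List (WithTop ℚ)) (fun s t : List (WithTop ℚ) => t ≤ s) := ⟨fun a b c h1 h2 => le_trans h2 h1⟩
  have hpw := List.pairwise_insertionSort (fun s t : List (WithTop ℚ) => t ≤ s) (childDeltas q A Γ)
  change List.Pairwise _ (scoreW q A Γ) at hpw
  rw [h] at hpw hs
  rcases List.mem_cons.mp hs with rfl | hs'
  · exact le_rfl
  · exact List.rel_of_pairwise_cons hpw hs'

/-! ## §3 R_W is δ-descending, hence wins -/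

/-- **R_W is `δ`-descending** (CARD I-8-1 (L1): domination over R_S of record + T1). [folklore] -/
theorem isDeltaDescending_ruleW (hq : 0 < q) : IsDeltaDescending q (ruleW q) := by
  refine isDeltaDescending_of_dominated hq (fun A hA => spinePermissible_ruleW hA) fun A hA j hj hnw => ?_
  -- the child's `δ` sits in `sc(R_W)`, which is lex-≤ `sc(R_S)`; compare heads
  have hmem : deltaSpine q (pureMove q (ruleW q A) j A) ∈ scoreW q A (ruleW q A) := by
    unfold scoreW; rw [List.mem_insertionSort]; exact mem_childDeltas hj hnw
  have hdom := scoreW_ruleW_le hA (SpineRuleLex.spinePermissible hq hA)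
  -- `sc(R_W)` is non-empty, so `sc(R_S)` is non-empty too (else `sc(R_W) ≤ [] ⇒ sc(R_W) = []`)
  obtain ⟨w₀, wr, hW⟩ : ∃ w₀ wr, scoreW q A (ruleW q A) = w₀ :: wr := by
    cases h : scoreW q A (ruleW q A) with
    | nil => rw [h] at hmem; simp at hmem
    | cons w₀ wr => exact ⟨w₀, wr, rfl⟩
  obtain ⟨s₀, sr, hS⟩ : ∃ s₀ sr, scoreW q A (spineRuleLex q A) = s₀ :: sr := by
    cases h : scoreW q A (spineRuleLex q A) with
    | nil =>
      exfalso
      rw [h, hW] at hdom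
      exact absurd hdom (not_le.mpr (List.nil_lt_cons w₀ wr))
    | cons s₀ sr => exact ⟨s₀, sr, rfl⟩
  -- heads: `w₀ ≤ s₀`
  have hhead : w₀ ≤ s₀ := by
    rw [hW, hS] at hdom
    rcases hdom.lt_or_eq with hlt | heq
    · rcases lex_cons_cons_iff'.mp hlt with h | ⟨h, -⟩
      · exact h.le
      · exact h.le
    · exact (List.cons.inj heq).1.le
  -- `s₀` is the `δ` of a (not-yet-won) child of R_S
  obtain ⟨j', hj', -, hs₀⟩ := exists_of_mem_scoreW (q := q) (A := A) (Γ := spineRuleLex q A) (s := s₀)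
    (by rw [hS]; exact List.mem_cons_self)
  have hle : deltaSpine q (pureMove q (ruleW q A) j A) ≤ deltaSpine q (pureMove q (spineRuleLex q A) j' A) :=
    ((le_head_scoreW hW hmem).trans hhead).trans (le_of_eq hs₀.symm)
  refine ⟨j', hj', fun hlex => ?_⟩
  have hlt : deltaSpine q (pureMove q (spineRuleLex q A) j' A) < deltaSpine q (pureMove q (ruleW q A) j A) := hlex
  exact absurd hlt (not_lt.mpr hle)
where
  /-- lex unpacking on lists of lists (the list order on `List (List (WithTop ℚ))`). -/
  lex_cons_cons_iff' {a b : List (WithTop ℚ)} {s t : List (List (WithTop ℚ))} :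
      a :: s < b :: t ↔ a < b ∨ (a = b ∧ s < t) := by
    constructor
    · intro h
      cases h with
      | cons h => exact Or.inr ⟨rfl, h⟩
      | rel h => exact Or.inl h
    · rintro (h | ⟨rfl, h⟩)
      · exact List.Lex.rel h
      · exact List.Lex.cons h

/-- **R_W WINS** (CARD I-8-1 (L1)+(L2) as a kernel theorem): for `0 < q`, the δ-steepest-descent rule is a positional
winning strategy of Hironaka's constrained polyhedra game in four variables (strict threshold). [folklore] -/
theorem isPurePositionalWin_ruleW (hq : 0 < q) : IsPurePositionalWin q (ruleW q) :=
  (isDeltaDescending_ruleW hq).isPurePositionalWin hq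

/-- R_W also wins the spine game with deletions. [folklore] -/
theorem isSpinePositionalWin_ruleW (hq : 0 < q) : IsSpinePositionalWin q (ruleW q) :=
  (isDeltaDescending_ruleW hq).isSpinePositionalWin hq

end RuleW

end Spivakovsky

end Summit.ResolutionOfSingularities.ResolutionOfSingularities.Theorems.PIDim4
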